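import Summits.RiemannHypothesis.RiemannHypothesis.Theorems.WeilTwoPrimeDeflM80PBase
import Literature.NumberTheory.LFunctions.WeilBlockRowsFast
import HarnessLib

/-!
# Even-sector deflated two-prime certificate M80P: the even Bessel block claim `Hp = C H Cᵀ`, rows 10–14, fast check

`WeilCert.checkHpRowT` (linear traversals, triangular `C`) + `WeilCert.checkHpRow_of_T` for certificate M80P (even block). Pure proof file.
-/

set_option linter.dupNamespace false

noncomputable section

namespace Summit.RiemannHypothesis.RiemannHypothesis.Theorems.EvenWinsBeyondArch

open Literature.NumberTheory.LFunctions

set_option maxHeartbeats 0 in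
/-- Fast kernel check of claim row 10 of `Hp = C H Cᵀ` (even block, certificate M80P). [folklore] -/
theorem checkHpRowT0_10_weilCertDeflM80P : weilCertDeflM80PBase.checkHpRowT weilCertDeflM80PHpE 0 10 = true := by
  decide +kernel

/-- Claim row 10 of `Hp = C H Cᵀ` (even block, certificate M80P), from the fast check. [folklore] -/
theorem checkHpRow0_10_weilCertDeflM80P : weilCertDeflM80PBase.checkHpRow weilCertDeflM80PHpE 0 10 = true :=
  WeilCert.checkHpRow_of_T checkHpRowT0_10_weilCertDeflM80P

set_option maxHeartbeats 0 in
/-- Fast kernel check of claim row 11 of `Hp = C H Cᵀ` (even block, certificate M80P). [folklore] -/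
theorem checkHpRowT0_11_weilCertDeflM80P : weilCertDeflM80PBase.checkHpRowT weilCertDeflM80PHpE 0 11 = true := by
  decide +kernel

/-- Claim row 11 of `Hp = C H Cᵀ` (even block, certificate M80P), from the fast check. [folklore] -/
theorem checkHpRow0_11_weilCertDeflM80P : weilCertDeflM80PBase.checkHpRow weilCertDeflM80PHpE 0 11 = true :=
  WeilCert.checkHpRow_of_T checkHpRowT0_11_weilCertDeflM80P

set_option maxHeartbeats 0 in
/-- Fast kernel check of claim row 12 of `Hp = C H Cᵀ` (even block, certificate M80P). [folklore] -/
theorem checkHpRowT0_12_weilCertDeflM80P : weilCertDeflM80PBase.checkHpRowT weilCertDeflM80PHpE 0 12 = true := by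
  decide +kernel

/-- Claim row 12 of `Hp = C H Cᵀ` (even block, certificate M80P), from the fast check. [folklore] -/
theorem checkHpRow0_12_weilCertDeflM80P : weilCertDeflM80PBase.checkHpRow weilCertDeflM80PHpE 0 12 = true :=
  WeilCert.checkHpRow_of_T checkHpRowT0_12_weilCertDeflM80P

set_option maxHeartbeats 0 in
/-- Fast kernel check of claim row 13 of `Hp = C H Cᵀ` (even block, certificate M80P). [folklore] -/
theorem checkHpRowT0_13_weilCertDeflM80P : weilCertDeflM80PBase.checkHpRowT weilCertDeflM80PHpE 0 13 = true := by
  decide +kernel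

/-- Claim row 13 of `Hp = C H Cᵀ` (even block, certificate M80P), from the fast check. [folklore] -/
theorem checkHpRow0_13_weilCertDeflM80P : weilCertDeflM80PBase.checkHpRow weilCertDeflM80PHpE 0 13 = true :=
  WeilCert.checkHpRow_of_T checkHpRowT0_13_weilCertDeflM80P

set_option maxHeartbeats 0 in
/-- Fast kernel check of claim row 14 of `Hp = C H Cᵀ` (even block, certificate M80P). [folklore] -/
theorem checkHpRowT0_14_weilCertDeflM80P : weilCertDeflM80PBase.checkHpRowT weilCertDeflM80PHpE 0 14 = true := by
  decide +kernel

/-- Claim row 14 of `Hp = C H Cᵀ` (even block, certificate M80P), from the fast check. [folklore] -/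
theorem checkHpRow0_14_weilCertDeflM80P : weilCertDeflM80PBase.checkHpRow weilCertDeflM80PHpE 0 14 = true :=
  WeilCert.checkHpRow_of_T checkHpRowT0_14_weilCertDeflM80P


end Summit.RiemannHypothesis.RiemannHypothesis.Theorems.EvenWinsBeyondArch
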